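import Summits.Parity.GeneralizedHardyLittlewood.Theses.LeeYangFibres
import Literature.NumberTheory.Sieve.LevelOfDistribution

/-!
# SketchIdeator5 — crux `RelativeDimOne` (stmt-Parity-14113), round-2 ideation (ideator 5), published copy of folder Sketch.lean

First-lemma signatures for the crux idea card

(card `single-moebius-ladder`, two moves)

* the Sawin–Shusterman split of ONE opened form at level `N^ϑ`: Type-I range = the whole
  Hardy–Littlewood main term (`TypeIMainTerm`; a THEOREM from Bombieri–Vinogradov when
  `ϑ + Θ < 1/2`, `typeIMainTerm_of_bv`; BFI-type when `1/2 < ϑ < 4/7`), large-divisor range = the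
  single-Möbius hybrid atom (`HybridOneMoebius 1`); no EH, no Cauchy–Schwarz
  (`pairs_of_typeI_and_hybrid`);
* inventor's paradox: the crux strengthened to polynomially large
  coefficients and log-power accuracy (`StrongDimOneAt`) is INDUCTIVE in the number of forms,
  each extra form costing one single-Möbius hybrid sum used pointwise (`ladder_step`), and the
  strengthened statement gives the crux back by pure bookkeeping (`relativeDimOne_of_strong`,
  PROVED below).

Only `relativeDimOne_of_strong` is proved; the other two are the lines' composition statements
(to be proved by a crux-plan seat), recorded here so that they elaborate.
-/

noncomputable section

open scoped BigOperators Classical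
open Filter Finset Literature.NumberTheory.Sieve
open Summit.Parity.GeneralizedHardyLittlewood.Theses.LeeYangFibres (RelativeDimOne DimOne)

namespace Summit.Parity.GeneralizedHardyLittlewood.Cruxes.RelativeDimOne.SingleMoebiusLadder

/-- **S⁺ (strengthened crux at `t` forms).** The `d = 1` Hardy–Littlewood statement for `t`
forms with POLYNOMIALLY LARGE coefficients and shifts (`‖Ψ‖_N ≤ L·N^θ`, i.e. `|ψ̇ᵢ| ≤ L N^θ`,
`|ψᵢ(0)| ≤ L N^{1+θ}`) and LOG-POWER accuracy `(β_∞𝔖 + N)/(log N)^A` in the crux's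
relative-plus-absolute format. `StrongDimOneAt t 0 A` for any `A > 0` contains the `t`-slice of
the crux (`relativeDimOne_of_strong`). -/
def StrongDimOneAt (t : ℕ) (θ A : ℝ) : Prop :=
  ∀ L : ℕ, ∃ N₀ : ℕ, ∀ N : ℕ, N₀ ≤ N → ∀ Ψ : Fin t → AffLinForm 1,
    IsNondegenerateSystem Ψ → affLinSize Ψ N ≤ L * (N : ℝ) ^ θ →
    ∀ K : Set (Fin 1 → ℝ), Convex ℝ K → K ⊆ realBox 1 N →
      |vonMangoldtSum Ψ K N - archFactor Ψ K * singularProduct Ψ| ≤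
        (archFactor Ψ K * singularProduct Ψ + N) / Real.log N ^ A

/-- **H_s (single-Möbius hybrid Hardy–Littlewood–Chowla atom).** ONE Möbius factor along a
form `φ₀` against `s` von Mangoldt factors along forms `φ₁, …, φ_s`, the whole system of
polynomially large size (`‖Φ‖_Y ≤ L·Y^C`: dilations `≤ L Y^C`, shifts `≤ L Y^{1+C}` — the Möbius
form INCLUDED: the ladder restricts `n` to progressions, so `φ₀ = q n + r` with `q ≤ L Y^C` must be
allowed, i.e. Möbius along an arithmetic progression of polynomially large modulus and polynomial
length, Sawin–Shusterman's Thm 1.7-type input over `𝔽_q[T]`), over any convex `K ⊆ [-Y, Y]`, with a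
log-power saving measured against the Hardy–Littlewood size of the prime tuple:
`|∑_{n ∈ K∩ℤ} μ(φ₀(n)) ∏_{i≥1} Λ(φᵢ(n))| ≤ (β_∞𝔖(φ₁,…,φ_s) + Y)/(log Y)^A`.
`s = 0` is cancellation of `μ` in progressions of modulus `≤ L Y^C` and length `≍ Y` (open beyond
`C < 1` even on GRH; conjectural folklore); `s = 1`, `φ₀ = n`, `φ₁ = g n + h` is "Möbius is
orthogonal to the dilated shifted primes" (stmt-Parity-0612 / Literature
`MoebiusShiftedPrimesConjecture` at `g = 1`) made uniform in `g ≤ Y^C`, `|h| ≤ L Y^{1+C}` and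
quantitative; the printed evidence is Lichtman–Teräväinen 2022 Thm 1.2 (average over the Möbius
shift, tree `lichtmanTeravainen2022_hlc_avg`) and, over `𝔽_q[T]`, Sawin–Shusterman Thm 4.5 /
Cor. 6.1 (dilated Möbius factors `μ(aᵢ + g Mᵢ)`). Non-degeneracy of the WHOLE system forbids
`φ₀ ∝ φᵢ` (else `μ(p)Λ(p) = −log p`). -/
def HybridOneMoebius (s : ℕ) (C A : ℝ) : Prop :=
  ∀ L : ℕ, ∃ Y₀ : ℕ, ∀ Y : ℕ, Y₀ ≤ Y → ∀ Φ : Fin (s + 1) → AffLinForm 1,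
    IsNondegenerateSystem Φ → affLinSize Φ Y ≤ L * (Y : ℝ) ^ C →
    ∀ K : Set (Fin 1 → ℝ), Convex ℝ K → K ⊆ realBox 1 Y →
      |∑ n ∈ (latticeBox 1 Y).filter (fun n => realPoint n ∈ K),
          (ArithmeticFunction.moebius ((Φ 0).eval n).toNat : ℝ) *
            ∏ i : Fin s, intVonMangoldt ((Φ i.succ).eval n)| ≤
        (archFactor (fun i : Fin s => Φ i.succ) K * singularProduct (fun i : Fin s => Φ i.succ) + Y) /
          Real.log Y ^ A

/-- **A (the Type-I range carries the whole main term).** For pair systems of size `≤ L N^Θ`,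
opening `Λ(ψ₀(n)) = −∑_{M ∣ ψ₀(n)} μ(M) log M` and keeping the divisors `M ≤ N^ϑ`:
`−∑_{M ≤ N^ϑ} μ(M) log M ∑_{n ∈ K∩ℤ, M ∣ ψ₀(n) > 0} Λ(ψ₁(n)) = β_∞𝔖 + O((β_∞𝔖 + N)/(log N)^A)`.
Content: primes `ψ₁(n)` in the progressions `{M ∣ ψ₀(n)}` to level `N^ϑ` with the weights
`μ(M) log M` (after Heath-Brown refinement of `μ`, weights of Bombieri–Friedlander–Iwaniec type:
tree `PrimesHaveWellFactorableLevel`, `bfi_wellFactorable_level` = level `4/7` for a FIXED residue)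
plus the truncated singular-series identity `−∑_{M ≤ D} μ(M) log M ρ(M)/φ(M) → 𝔖`
(Goldston–Yıldırım Lemma 2.1 / Sawin–Shusterman Prop. 6.2). The open part is uniformity in the
shift `|ψᵢ(0)| ≤ L N^{1+Θ}` (print: Drappeau 2017, `|a| ≤ x^δ`). -/
def TypeIMainTerm (Θ ϑ A : ℝ) : Prop :=
  ∀ L : ℕ, ∃ N₀ : ℕ, ∀ N : ℕ, N₀ ≤ N → ∀ Ψ : Fin 2 → AffLinForm 1,
    IsNondegenerateSystem Ψ → affLinSize Ψ N ≤ L * (N : ℝ) ^ Θ →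
    ∀ K : Set (Fin 1 → ℝ), Convex ℝ K → K ⊆ realBox 1 N →
      |(-∑ M ∈ Icc 1 ⌊(N : ℝ) ^ ϑ⌋₊, (ArithmeticFunction.moebius M : ℝ) * Real.log M *
            ∑ n ∈ (latticeBox 1 N).filter
                (fun n => realPoint n ∈ K ∧ (M : ℤ) ∣ (Ψ 0).eval n ∧ 0 < (Ψ 0).eval n),
              intVonMangoldt ((Ψ 1).eval n)) -
          archFactor Ψ K * singularProduct Ψ| ≤
        (archFactor Ψ K * singularProduct Ψ + N) / Real.log N ^ A

/-- **First lemma of card `eh-free-moebius-split` (composition, to be proved by crux-plan).**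
The Sawin–Shusterman split at level `ϑ ∈ (1/2, 4/7)`: the small-divisor range is `TypeIMainTerm`,
the large-divisor range `M > N^ϑ` is, after the switch `g = ψ₀(n)/M ≤ L N^{1−ϑ+Θ}`, a sum over
`g` of single-Möbius hybrid sums of length `≍ N/g ≥ N^{ϑ−Θ}/L` along the pair
`(φ₀, φ₁) = (M, (ψ̇₁ g M + Δ)/ψ̇₀)` of size `≤ Y^{C}`, `C = (1 + Θ)/(ϑ − Θ)`; the `log M` weight and
the `∑_g 1/φ(g) ≍ log N` excess cost three logarithms. No Elliott–Halberstam, no Cauchy–Schwarz. -/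
theorem pairs_of_typeI_and_hybrid (Θ ϑ A : ℝ) (hΘ : 0 ≤ Θ) (hϑ : Θ < ϑ) (hϑ1 : Θ + ϑ < 1)
    (hA : TypeIMainTerm Θ ϑ (A + 3))
    (hH : ∀ C : ℝ, HybridOneMoebius 1 C (A + 3)) :
    StrongDimOneAt 2 Θ A := by
  sorry

/-- **The Type-I atom below level `1/2` is a THEOREM of the tree's inputs (to be proved by
crux-plan; provable now).** For `Θ + ϑ < 1/2` the moduli `M·(bounded) ≤ N^{ϑ+Θ+o(1)}` are inside
Bombieri–Vinogradov (`Literature.NumberTheory.Sieve.bombieri_vinogradov`, PROVED: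
`bombieri_vinogradov_holds`; its `max_{y ≤ x} max_{(a,q)=1}` form gives uniformity in ALL shifts
`|ψᵢ(0)| ≤ L N^{1+Θ}` for free), and the truncated singular series is Goldston–Yıldırım Lemma 2.1
(tree `goldstonYildirim_lemma21*`). The price is paid by the hybrid atom, whose dilations then
reach `g ≤ L N^{1−ϑ+Θ} > N^{1/2}` (`C > 1`: dilation larger than the length of the Möbius sum). -/
theorem typeIMainTerm_of_bv (Θ ϑ A : ℝ) (hΘ : 0 ≤ Θ) (hϑ : 0 < ϑ) (h : Θ + ϑ < 1 / 2) :
    TypeIMainTerm Θ ϑ A := by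
  sorry

/-- **First lemma of card `single-moebius-ladder` (induction step, to be proved by crux-plan).**
Open the LAST form: `Λ(ψ_t(n)) = −∑_{M ∣ ψ_t(n)} μ(M) log M`. Divisors `M ≤ N^{θ'}`: the inner sum
is the `t`-form statement for the system `ψᵢ(r_M + M·)` at scale `N' = N/M ≥ N^{1−θ'}`, of size
`≤ L N^{θ+θ'} ≤ L N'^{(θ+θ')/(1−θ')}` — used POINTWISE in `M` (no level of distribution for prime tuples); divisors
`M > N^{θ'}`: `g = ψ_t(n)/M ≤ L N^{1−θ'+θ}` and the `M`-sum is a single-Möbius hybrid sum with `t`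
prime factors of length `≥ N^{θ'}/L`; the truncated singular series over `M ≤ N^{θ'}` recombines
to `𝔖(ψ₀,…,ψ_t)`; three logarithms are lost. -/
theorem ladder_step (t : ℕ) (ht : 1 ≤ t) (θ θ' A : ℝ) (hθ : 0 ≤ θ) (hθ' : 0 < θ') (hsum : θ + θ' < 1)
    (hS : StrongDimOneAt t ((θ + θ') / (1 - θ')) (A + 3))
    (hH : ∀ C : ℝ, HybridOneMoebius t C (A + 3)) :
    StrongDimOneAt (t + 1) θ A := by
  sorry

/-- **Bookkeeping (PROVED): the strengthened statement contains the crux.** At `θ = 0` the size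
hypothesis is the crux's `‖Ψ‖_N ≤ L`, and `(β_∞𝔖 + N)/(log N)^A ≤ ε(β_∞𝔖 + N)` once
`(log N)^A ≥ 1/ε` (when `β_∞𝔖 + N < 0` the hypothesis is contradictory, so nothing is to prove). -/
theorem relativeDimOne_of_strong
    (h : ∀ t : ℕ, 1 ≤ t → ∃ A : ℝ, 0 < A ∧ StrongDimOneAt t 0 A) : RelativeDimOne := by
  intro t L ht ε hε
  obtain ⟨A, hA, hS⟩ := h t ht
  obtain ⟨N₀, hN₀⟩ := hS L
  have hev : ∀ᶠ N : ℕ in atTop, 1 / ε ≤ Real.log N ^ A := by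
    have h1 : Tendsto (fun N : ℕ => Real.log (N : ℝ) ^ A) atTop atTop :=
      (tendsto_rpow_atTop hA).comp (Real.tendsto_log_atTop.comp tendsto_natCast_atTop_atTop)
    exact h1.eventually_ge_atTop (1 / ε)
  obtain ⟨N₁, hN₁⟩ := eventually_atTop.1 hev
  refine ⟨max N₀ N₁, fun N hN Ψ hΨ hsize K hK hKbox => ?_⟩
  have hN0 : N₀ ≤ N := le_of_max_le_left hN
  have hN1 : N₁ ≤ N := le_of_max_le_right hN
  have hsize' : affLinSize Ψ N ≤ L * (N : ℝ) ^ (0 : ℝ) := by simpa using hsize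
  have key := hN₀ N hN0 Ψ hΨ hsize' K hK hKbox
  have hlog : 1 / ε ≤ Real.log N ^ A := hN₁ N hN1
  have hlogpos : 0 < Real.log N ^ A := lt_of_lt_of_le (by positivity) hlog
  set X : ℝ := archFactor Ψ K * singularProduct Ψ + N with hX
  by_cases hXnn : 0 ≤ X
  · refine key.trans ?_
    rw [div_le_iff₀ hlogpos]
    have : X ≤ ε * X * Real.log N ^ A := by
      have h2 : 1 ≤ ε * Real.log N ^ A := by
        rw [div_le_iff₀ hε] at hlog
        linarith [hlog]
      nlinarith
    linarith
  · exfalso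
    rw [not_le] at hXnn
    have : X / Real.log N ^ A < 0 := div_neg_of_neg_of_pos hXnn hlogpos
    linarith [abs_nonneg (vonMangoldtSum Ψ K N - archFactor Ψ K * singularProduct Ψ), key]

end Summit.Parity.GeneralizedHardyLittlewood.Cruxes.RelativeDimOne.SingleMoebiusLadder
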